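/-
Copyright (c) 2026 the pub-hodgecm-mathlib formalisation cell (harness21).  Prover seat hodgecm-mathlib-K2E3-p04 (g0), Track B ∕ K2-LIT
(build stream 29), h413 = `stmt-HodgeConjecture-24833`, line `K2_E3_EllipticInputs`, unit U4 «Keys» — DEAL `K2E3RankOneIntertwiningIntegral`, RUNG 3 (convergence),
STEP 2a «MAJORANT»: the CM-specific inputs of the height-shell summation.  2026-09-03.
-/
import Summits.HodgeConjecture.HodgeConjecture.Theorems.F0P3cStCharTSKeys3AnnulusDock          -- ★ `isCompact_normBall`, `continuous_norm_entry`; brings ★ B4 far out, ★ (β) `entry_torusConj`, ★ DICT (`prod_normAbs_*`, `isUnit_iff_ne_zero_localRing`), ★ `distribHaarChar_torus` ∕ `distribHaarChar_map_eq`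
import Summits.HodgeConjecture.HodgeConjecture.Theorems.F0P3cStCharTSPrincipalSeriesUnitary     -- ★ `norm_apply_normOneUnits_eq_one` (`|χ₂| = 1` on the compact `E¹_v`)
import HarnessLib

/-!
# h413 ∕ Track B «K2-LIT», unit U4 «Keys», DEAL `K2E3RankOneIntertwiningIntegral` — RUNG 3 STEP 2a «MAJORANT»: on `N(L⁺_v)` (`v` non-split) the height `m(u) = ‖u₀₂‖`
# scales by `‖t₀₀‖⁻²` under `Ad(t⁻¹)`, and the cell function of ANY section of `i_G(χ₁, χ₂)` with `|χ₁| = ‖·‖^σ` is EXACTLY `‖f(1)‖ · m^{-(σ+1)}` far out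

Cell `pub/hodgecm-mathlib`, crux H413 = `stmt-HodgeConjecture-24833` (lane `--supports … --as helper`), route HCCMUnconditional; dealer K2E3-plan (g1) (DEALS BATCH #1
2026-09-03T22:03Z «p04 DEAL `K2E3RankOneIntertwiningIntegral` … absolute convergence for `χ₁ = η‖·‖_E^s`, `Re s > s₀`»).  THEOREMS ONLY (0 def ∕ 0 instance ∕ 0 notation ∕ 0 sorry);
★-only imports.  These are the three `U(3)`-specific inputs of ★ `K2E3IntertwiningIntegralShellBound.integrableOn_rpow_neg_of_scaling` (STEP 1, generic); STEP 2b
(`K2E3RankOneIntertwiningIntegralConvergence`) assembles them into the `hint₀` of ★ `K2E3RankOneIntertwiningIntegral.exists_intertwiningIntegral_cmPrincipalSeries`.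

WHAT.  `R = ∏_{w ∣ v} L_w` (`v` NON-SPLIT: one place `w`, `R` a field), `σ = c ⊗ 1`, `G = U(Φ₃)(L⁺_v)`, `B = TN`, `w₀` of matrix `Φ₃`; the HEIGHT of `u ∈ N` is
`m(u) := Π_{w′} |(u₀₂)_{w′}|_{w′}` (`= ‖u₀₂‖_R` on units, ★ `unitModulusChar_localRing_eq_prod`), the norm of record of ★ `F0P3cStCharTSKeys3AnnulusDock` (norm balls `K_A = {m ≤ A}`).
* §1 **`height_torusConj`** — for `t = diag(d) ∈ T`: `m(t⁻¹ u t) = ‖d₀‖⁻¹ · ‖d₀‖⁻¹ · m(u)` (★ (β) `entry_torusConj`: `(t⁻¹ut)₀₂ = d₀⁻¹ u₀₂ d₂`; ★ DICT `prod_normAbs_units_mul`;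
  ★ `distribHaarChar_torus`: `‖d₂‖ = ‖d₀‖⁻¹`) — the `hmc` of STEP 1 with `Q = ‖d₀‖⁻²`.
* §2 **`norm_cellFun_eq_far_out`** — for `χ₁` with `‖χ₁(x)‖ = ‖x‖^σ` (`σ ∈ ℝ`; `χ₁ = η‖·‖^s`, `σ = Re s`), `χ₂` continuous and ANY `f` in the carrier of ★ `cmPrincipalSeries L 3 v (χ₁, χ₂)`:
  there is `A₀ > 0` with **`‖f(w₀ u)‖ = ‖f(1)‖ · m(u)^{-(σ+1)}`** whenever `m(u) > A₀` (★ B4 `exists_toFun_weylElt_mul_eq_smul_toFun_one`: `f(w₀u) = χ₁(σb)⁻¹ χ₂(−1) ‖b‖⁻¹ · f(1)`;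
  `‖σ b‖ = ‖b‖` ★ `distribHaarChar_map_eq`; `|χ₂(−1)| = 1` ★ `norm_apply_normOneUnits_eq_one`; a non-zero entry is a unit at a non-split place ★ `isUnit_iff_ne_zero_localRing`).
* §3 **`integrableOn_cellFun_normBall`** — the cell function of any section is integrable on every norm ball `K_A` against any measure finite on compacts (it is continuous —
  locally constant, ★ `SmoothInd.continuous_cellFun` — and `K_A` is compact, ★ `isCompact_normBall`); `measure_normBall_lt_top`.
[Casselman1995, §6.4 p. 63: «`|f(w n)| ≤ C δ^{1∕2}|χ|(a(wn))` … the integral over `N` reduces to a geometric series»]; [Keys1984, §3]; [Rogawski1990, §12.2 p. 173].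

HONEST LABEL.  HC_CM is proved only modulo the 7 printed citations (2 remaining named inputs: hLiu418 = `stmt-HodgeConjecture-24832`, h413 = `stmt-HodgeConjecture-24833`) until
rung 0 closes; count-neutral.

## References
* [Casselman1995] W. Casselman, *Introduction to the theory of admissible representations of `p`-adic reductive groups* (1995), §6.4 pp. 62–64, Prop. 1.3.3.
* [Keys1984] D. Keys, *Principal series representations of special unitary groups over local fields*, Compositio Math. 51 (1984), §3.
* [Rogawski1990] J. D. Rogawski, *Automorphic Representations of Unitary Groups in Three Variables*, Ann. of Math. Stud. 123 (1990), §1.10 p. 9, §12.2 p. 173.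
* [WeilBNT1967] A. Weil, *Basic Number Theory* (1967), Ch. I §2 (the module of a local field).
-/

set_option autoImplicit false
-- the mandated namespace repeats the single-problem summit's segment (`HodgeConjecture.HodgeConjecture`)
set_option linter.dupNamespace false

noncomputable section

open NumberField IsDedekindDomain MeasureTheory
open scoped Matrix NNReal ENNReal

open Literature.NumberTheory Literature.NumberTheory.Automorphic Literature.NumberTheory.Automorphic.UnitaryGroup
open Literature.NumberTheory.GaloisRepresentations Literature.NumberTheory.GaloisRepresentations.IsNonarchimedeanLocalField

namespace Summit.HodgeConjecture.HodgeConjecture.Cruxes.H413.K2E3IntertwiningIntegralMajorant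

variable (L : Type) [Field L] [NumberField L] [IsCMField L] (v : HeightOneSpectrum (𝓞 ↥(maximalRealSubfield L)))
  (hns : ∀ w : PlacesOver L v, IsCMField.complexConj L • w.1 = w.1)

/-! ## §1 The height `m(u) = Π_w |(u₀₂)_w|_w` scales by `‖d₀‖⁻²` under `u ↦ t⁻¹ u t` -/

set_option maxHeartbeats 400000 in
/-- **`m(t⁻¹ u t) = ‖d₀‖⁻¹ · ‖d₀‖⁻¹ · m(u)`** for `t = diag(d) ∈ T(L⁺_v)`, `u ∈ N(L⁺_v)` (every finite `v`): `(t⁻¹ u t)₀₂ = d₀⁻¹ u₀₂ d₂` (★ `entry_torusConj`), the height is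
multiplicative in units (★ `prod_normAbs_units_mul`) and `‖d₂‖ = ‖d₀‖⁻¹` on the torus of `U(Φ₃)` (★ `distribHaarChar_torus`). [cite: Rogawski1990, §1.10 p. 9] [cite: WeilBNT1967, Ch. I §2] -/
theorem height_torusConj [MeasurableSpace (LocalRing L v)] [BorelSpace (LocalRing L v)]
    (t : ↥(cmBorelTriple L 3 v).M) {d : Fin 3 → (LocalRing L v)ˣ}
    (hd : glDiagonal 3 (LocalRing L v) d = ((t : ↥(unitaryGroupOfForm (conjLocal L (IsCMField.complexConj L) v) (cmLocalForm L 3 v))) : GL (Fin 3) (LocalRing L v)))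
    (u : ↥(cmBorelTriple L 3 v).N) :
    (∏ w' : PlacesOver L v, normAbs (w'.1.adicCompletion L) (((((((HeisRing.torusConj (conjLocal L (IsCMField.complexConj L) v) t u : ↥(cmBorelTriple L 3 v).N) : ↥(unitaryGroupOfForm (conjLocal L (IsCMField.complexConj L) v) (cmLocalForm L 3 v)))) : GL (Fin 3) (LocalRing L v)) : Matrix (Fin 3) (Fin 3) (LocalRing L v)) 0 2) w')) =
      (distribHaarChar (LocalRing L v) (d 0))⁻¹ * (distribHaarChar (LocalRing L v) (d 0))⁻¹ * (∏ w' : PlacesOver L v, normAbs (w'.1.adicCompletion L) ((((((u : ↥(unitaryGroupOfForm (conjLocal L (IsCMField.complexConj L) v) (cmLocalForm L 3 v)))) : GL (Fin 3) (LocalRing L v)) : Matrix (Fin 3) (Fin 3) (LocalRing L v)) 0 2) w')) := by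
  have hent : ((((((HeisRing.torusConj (conjLocal L (IsCMField.complexConj L) v) t u : ↥(cmBorelTriple L 3 v).N) : ↥(unitaryGroupOfForm (conjLocal L (IsCMField.complexConj L) v) (cmLocalForm L 3 v)))) : GL (Fin 3) (LocalRing L v)) : Matrix (Fin 3) (Fin 3) (LocalRing L v)) 0 2) =
      ((((d 0)⁻¹ * d 2 : (LocalRing L v)ˣ) : LocalRing L v)) * (((((u : ↥(unitaryGroupOfForm (conjLocal L (IsCMField.complexConj L) v) (cmLocalForm L 3 v)))) : GL (Fin 3) (LocalRing L v)) : Matrix (Fin 3) (Fin 3) (LocalRing L v)) 0 2) := by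
    rw [F0P3cStCharTSKeys3TorusConjBall.entry_torusConj (conjLocal L (IsCMField.complexConj L) v) t hd u 0 2, Units.val_mul, mul_right_comm, mul_assoc]
  have hd2 : distribHaarChar (LocalRing L v) (d 2) = (distribHaarChar (LocalRing L v) (d 0))⁻¹ :=
    (HeisRing.distribHaarChar_torus (conjLocal L (IsCMField.complexConj L) v) (conjLocal_conjLocal_cm L v)
      (continuous_conjLocal L (IsCMField.complexConj L) v) (cmLocalForm_eq_over L 3 v) t hd).2
  simp_rw [hent]
  rw [F0P3cStCharTSLocalRingNormDictionary.prod_normAbs_units_mul, map_mul, map_inv, hd2]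

/-! ## §2 Far out the cell function of a section of `i_G(χ₁, χ₂)`, `|χ₁| = ‖·‖^σ`, has norm EXACTLY `‖f(1)‖ · m^{-(σ+1)}` -/

set_option synthInstance.maxHeartbeats 400000 in
set_option maxHeartbeats 4000000 in
-- statement over the `SmoothInd` carrier of ★ `cmPrincipalSeries` (class of ★ B4 `F0P3cStCharTSCellFunFarOut`)
include hns in
/-- **FAR-OUT MAJORANT (exact)**.  `v` NON-SPLIT, `w₀` of matrix `Φ₃`, `χ₂` continuous and `χ₁` with `‖χ₁(x)‖ = ‖x‖^σ` for all units `x` (`σ ∈ ℝ`): for every `f` in the carrier of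
★ `cmPrincipalSeries L 3 v (cmTorusCharPair L v χ₁ χ₂)` there is `A₀ > 0` such that `‖f(w₀ u)‖ = ‖f(1)‖ · m(u)^{-(σ+1)}` for every `u ∈ N` of height `m(u) > A₀` — ★ B4
`f(w₀ u) = χ₁(σb)⁻¹ χ₂(−1) ‖b‖⁻¹ · f(1)` (`b = u₀₂`, a unit since `m(u) > 0`, ★ `isUnit_iff_ne_zero_localRing`), `‖χ₁(σb)⁻¹‖ = ‖σ b‖^{-σ} = ‖b‖^{-σ}` (★ `distribHaarChar_map_eq`),
`|χ₂(−1)| = 1` (★ `norm_apply_normOneUnits_eq_one`), `‖b‖ = m(u)` (★ `unitModulusChar_localRing_eq_prod`). [cite: Casselman1995, §6.4 p. 63] [cite: Keys1984, §3] [cite: Rogawski1990, §12.2 p. 173] -/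
theorem norm_cellFun_eq_far_out [MeasurableSpace (LocalRing L v)] [BorelSpace (LocalRing L v)]
    (χ₁ : (LocalRing L v)ˣ →* ℂˣ) (χ₂ : ↥(normOneUnits (conjLocal L (IsCMField.complexConj L) v)) →* ℂˣ)
    (h₂ : Continuous fun x => ((χ₂ x : ℂˣ) : ℂ)) {σ : ℝ}
    (hχ₁ : ∀ x : (LocalRing L v)ˣ, ‖((χ₁ x : ℂˣ) : ℂ)‖ = ((unitModulusChar (LocalRing L v) x : ℝ≥0) : ℝ) ^ σ)
    (w₀ : ↥(unitaryGroupOfForm (conjLocal L (IsCMField.complexConj L) v) (cmLocalForm L 3 v)))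
    (hw₀ : Units.val (w₀ : GL (Fin 3) (LocalRing L v)) = cmLocalForm L 3 v)
    (f : haveI := locallyCompactSpace_cmBorelU L 3 v
      Representation.SmoothInd (cmBorelTriple L 3 v).P
        (Representation.twist
          (((Representation.trivial ℂ ↥(torusU (conjLocal L (IsCMField.complexConj L) v) (cmLocalForm L 3 v)) ℂ).twist
            (cmTorusCharPair L v χ₁ χ₂)).comp (cmBorelTriple L 3 v).proj) (rootDeltaChar (cmBorelTriple L 3 v).P))) :
    ∃ A₀ : ℝ, 0 < A₀ ∧ ∀ u : ↥(cmBorelTriple L 3 v).N, A₀ < (((∏ w' : PlacesOver L v, normAbs (w'.1.adicCompletion L) ((((((u : ↥(unitaryGroupOfForm (conjLocal L (IsCMField.complexConj L) v) (cmLocalForm L 3 v)))) : GL (Fin 3) (LocalRing L v)) : Matrix (Fin 3) (Fin 3) (LocalRing L v)) 0 2) w')) : ℝ≥0) : ℝ) →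
      ‖f.toFun (w₀ * (u : ↥(unitaryGroupOfForm (conjLocal L (IsCMField.complexConj L) v) (cmLocalForm L 3 v))))‖ = ‖f.toFun 1‖ * (((∏ w' : PlacesOver L v, normAbs (w'.1.adicCompletion L) ((((((u : ↥(unitaryGroupOfForm (conjLocal L (IsCMField.complexConj L) v) (cmLocalForm L 3 v)))) : GL (Fin 3) (LocalRing L v)) : Matrix (Fin 3) (Fin 3) (LocalRing L v)) 0 2) w')) : ℝ≥0) : ℝ) ^ (-(σ + 1)) := by
  haveI := locallyCompactSpace_cmBorelU L 3 v
  obtain ⟨w⟩ : Nonempty (PlacesOver L v) := inferInstance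
  have hw := hns w
  obtain ⟨A₀, hA₀⟩ := F0P3cStCharTSCellFunFarOut.exists_toFun_weylElt_mul_eq_smul_toFun_one L v hns χ₁ χ₂ w₀ hw₀ f
  refine ⟨max (A₀ : ℝ) 1, lt_max_of_lt_right one_pos, fun u hu => ?_⟩
  -- the entry `b = u₀₂` is a unit of height `m(u) = ‖b‖ ≥ A₀`
  have hmpos : (0 : ℝ) < (((∏ w' : PlacesOver L v, normAbs (w'.1.adicCompletion L) ((((((u : ↥(unitaryGroupOfForm (conjLocal L (IsCMField.complexConj L) v) (cmLocalForm L 3 v)))) : GL (Fin 3) (LocalRing L v)) : Matrix (Fin 3) (Fin 3) (LocalRing L v)) 0 2) w')) : ℝ≥0) : ℝ) := lt_trans (lt_max_of_lt_right one_pos) hu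
  have hb0 : (((((u : ↥(unitaryGroupOfForm (conjLocal L (IsCMField.complexConj L) v) (cmLocalForm L 3 v)))) : GL (Fin 3) (LocalRing L v)) : Matrix (Fin 3) (Fin 3) (LocalRing L v)) 0 2) ≠ 0 := by
    intro h0
    rw [(F0P3cStCharTSLocalRingNormDictionary.prod_normAbs_eq_zero_iff L v w hw _).2 h0, NNReal.coe_zero] at hmpos
    exact lt_irrefl _ hmpos
  have hb : IsUnit (((((u : ↥(unitaryGroupOfForm (conjLocal L (IsCMField.complexConj L) v) (cmLocalForm L 3 v)))) : GL (Fin 3) (LocalRing L v)) : Matrix (Fin 3) (Fin 3) (LocalRing L v)) 0 2) := (F0P3cStCharTSLocalRingNormDictionary.isUnit_iff_ne_zero_localRing L v w hw _).2 hb0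
  have hnorm : unitModulusChar (LocalRing L v) hb.unit = (∏ w' : PlacesOver L v, normAbs (w'.1.adicCompletion L) ((((((u : ↥(unitaryGroupOfForm (conjLocal L (IsCMField.complexConj L) v) (cmLocalForm L 3 v)))) : GL (Fin 3) (LocalRing L v)) : Matrix (Fin 3) (Fin 3) (LocalRing L v)) 0 2) w')) := by
    rw [unitModulusChar_localRing_eq_prod, hb.unit_spec]
  have hle : A₀ ≤ unitModulusChar (LocalRing L v) hb.unit := by
    rw [hnorm, ← NNReal.coe_le_coe]
    exact (le_max_left _ _).trans hu.le
  have hX : (0 : ℝ) < ((unitModulusChar (LocalRing L v) hb.unit : ℝ≥0) : ℝ) := by rw [hnorm]; exact hmpos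
  -- ★ B4 and the norm of the scalar
  rw [hA₀ u hb hle, norm_smul, mul_comm, ← hnorm]
  congr 1
  have h1 : ‖((((χ₁ (Units.map (conjLocal L (IsCMField.complexConj L) v : LocalRing L v →* LocalRing L v) hb.unit))⁻¹ : ℂˣ) : ℂ))‖ =
      (((unitModulusChar (LocalRing L v) hb.unit : ℝ≥0) : ℝ) ^ σ)⁻¹ := by
    rw [Units.val_inv_eq_inv_val, norm_inv, hχ₁]
    unfold unitModulusChar
    rw [HeisRing.distribHaarChar_map_eq (conjLocal L (IsCMField.complexConj L) v) (conjLocal_conjLocal_cm L v)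
      (continuous_conjLocal L (IsCMField.complexConj L) v)]
  have h2 : ‖((χ₂ ⟨-1, F0P3cStCharTSBigCellFactorisation.neg_one_mem_normOneUnits (conjLocal L (IsCMField.complexConj L) v)⟩ : ℂˣ) : ℂ)‖ = 1 :=
    F0P3cStCharTSPrincipalSeriesUnitary.norm_apply_normOneUnits_eq_one L v hns χ₂ h₂ _
  have h3 : ‖((((((unitModulusChar (LocalRing L v) hb.unit)⁻¹ : ℝ≥0) : ℝ)) : ℂ))‖ = (((unitModulusChar (LocalRing L v) hb.unit : ℝ≥0) : ℝ))⁻¹ := by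
    rw [Complex.norm_real, NNReal.coe_inv, Real.norm_of_nonneg (inv_nonneg.2 hX.le)]
  rw [norm_mul, norm_mul, h1, h2, h3, mul_one, ← Real.rpow_neg hX.le, ← Real.rpow_neg_one, ← Real.rpow_add hX, neg_add]

/-! ## §3 On every norm ball the cell function is integrable -/

include hns in
/-- The norm ball `K_A = {m ≤ A}` has finite measure for any measure finite on compacts (★ `isCompact_normBall`). [cite: Casselman1995, §6.3] -/
theorem measure_normBall_lt_top [MeasurableSpace ↥(cmBorelTriple L 3 v).N] (μ : Measure ↥(cmBorelTriple L 3 v).N) [IsFiniteMeasureOnCompacts μ] (A : ℝ) :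
    μ {u : ↥(cmBorelTriple L 3 v).N | (((∏ w' : PlacesOver L v, normAbs (w'.1.adicCompletion L) ((((((u : ↥(unitaryGroupOfForm (conjLocal L (IsCMField.complexConj L) v) (cmLocalForm L 3 v)))) : GL (Fin 3) (LocalRing L v)) : Matrix (Fin 3) (Fin 3) (LocalRing L v)) 0 2) w')) : ℝ≥0) : ℝ) ≤ A} < ∞ :=
  (F0P3cStCharTSKeys3AnnulusDock.isCompact_normBall L v hns A).measure_lt_top

set_option synthInstance.maxHeartbeats 400000 in
set_option maxHeartbeats 4000000 in
-- statement over the `SmoothInd` carrier of ★ `cmPrincipalSeries` (class of ★ B4)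
include hns in
/-- **The cell function `u ↦ f(g u)` of a section is integrable on every norm ball `K_A`** against any measure on `N(L⁺_v)` finite on compacts: it is continuous (★
`SmoothInd.continuous_cellFun`) and `K_A` is compact (★ `isCompact_normBall`). [cite: Casselman1995, §6.3, §6.4 p. 63] -/
theorem integrableOn_cellFun_normBall (χ : ↥(torusU (conjLocal L (IsCMField.complexConj L) v) (cmLocalForm L 3 v)) →* ℂˣ)
    (g : ↥(unitaryGroupOfForm (conjLocal L (IsCMField.complexConj L) v) (cmLocalForm L 3 v)))
    [MeasurableSpace ↥(cmBorelTriple L 3 v).N] [BorelSpace ↥(cmBorelTriple L 3 v).N] (μ : Measure ↥(cmBorelTriple L 3 v).N) [IsFiniteMeasureOnCompacts μ]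
    (f : haveI := locallyCompactSpace_cmBorelU L 3 v
      Representation.SmoothInd (cmBorelTriple L 3 v).P
        (Representation.twist
          (((Representation.trivial ℂ ↥(torusU (conjLocal L (IsCMField.complexConj L) v) (cmLocalForm L 3 v)) ℂ).twist χ).comp (cmBorelTriple L 3 v).proj)
          (rootDeltaChar (cmBorelTriple L 3 v).P))) (A : ℝ) :
    IntegrableOn (fun u : ↥(cmBorelTriple L 3 v).N => f.toFun (g * (u : ↥(unitaryGroupOfForm (conjLocal L (IsCMField.complexConj L) v) (cmLocalForm L 3 v)))))
      {u : ↥(cmBorelTriple L 3 v).N | (((∏ w' : PlacesOver L v, normAbs (w'.1.adicCompletion L) ((((((u : ↥(unitaryGroupOfForm (conjLocal L (IsCMField.complexConj L) v) (cmLocalForm L 3 v)))) : GL (Fin 3) (LocalRing L v)) : Matrix (Fin 3) (Fin 3) (LocalRing L v)) 0 2) w')) : ℝ≥0) : ℝ) ≤ A} μ := by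
  haveI := locallyCompactSpace_cmBorelU L 3 v
  have hcont : Continuous fun u : ↥(cmBorelTriple L 3 v).N => f.toFun (g * (u : ↥(unitaryGroupOfForm (conjLocal L (IsCMField.complexConj L) v) (cmLocalForm L 3 v)))) :=
    SmoothInd.continuous_cellFun (cmBorelTriple L 3 v).P _ (cmBorelTriple L 3 v).N.subtype g continuous_subtype_val f
  exact hcont.continuousOn.integrableOn_compact (F0P3cStCharTSKeys3AnnulusDock.isCompact_normBall L v hns A)

end Summit.HodgeConjecture.HodgeConjecture.Cruxes.H413.K2E3IntertwiningIntegralMajorant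

end
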